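import Summits.Ventures.MM22.Rank234.RealizeVectors
import Summits.Ventures.MM22.Rank234.CensusCheck
import HarnessLib

/-!
# Cell pub-mm22 — realizability checker, part 3: the dimension count and the tight-functional lemma

Cell `pub-mm22` (MatrixMultiplication venture; seat engine-1 g9), topic `Summits/Ventures/MM22`.
HONEST FRAMING: checker PLUMBING, not a bound and not a result.  Contents: the dimension count
(`mem_and_not_mem_of_tight`: `W ≤ A + span(v '' I)`, `dim A ≤ a`, `r ≤ dim (W + A)`, `a + #I ≤ r` ⇒ every
`v t`, `t ∈ I`, lies in `W + A` and outside `A`); the SLICE identity of a computation `β` of `ψ_K`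
(`uvec_eq_sum`: `(x_s E_b)_s = ∑_i g_i(E_b) · ((f_i(x_s))_s ⊗ w_i)`, i.e. the defining identity of `β` read
in bits — de Groote 1978 Prop. 1.2 is its corollary); profile bookkeeping under a permutation hypothesis; and
`LCert.sound`: a passing tight-functional certificate forces, for every unassigned product meeting the points,
annihilation by `Y` and non-membership in `A`.  No new facts.
-/

namespace Summit.Ventures.MM22.GF2Cert.Realize

open Summit.MatrixMultiplication.OmegaCensus.GF2RankLB
open Summit.Ventures.MM22.GF2Cert.Profile
open Literature.Computability.AlgebraicComplexity
open Module Matrix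

/-! ### The dimension count -/

section Count

/-- The span of finitely many images has dimension at most the number of indices. -/
theorem finrank_span_image_le {M : Type*} [AddCommGroup M] [Module (ZMod 2) M] [DecidableEq M]
    {ι : Type*} (I : Finset ι) (v : ι → M) :
    finrank (ZMod 2) (Submodule.span (ZMod 2) ((I.image v : Finset M) : Set M)) ≤ I.card :=
  (finrank_span_finset_le_card _).trans Finset.card_image_le

variable {M : Type*} [AddCommGroup M] [Module (ZMod 2) M] [FiniteDimensional (ZMod 2) M]
  {ι : Type*} [DecidableEq ι] [DecidableEq M]

omit [DecidableEq ι] in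
/-- The upper count: `dim (W + A) ≤ dim A + #I` when `W ≤ A + span (v '' I)`. -/
theorem finrank_sup_le_of_le (W A : Submodule (ZMod 2) M) (v : ι → M) (I : Finset ι)
    (hW : W ≤ A ⊔ Submodule.span (ZMod 2) ((I.image v : Finset M) : Set M)) :
    finrank (ZMod 2) ↥(W ⊔ A) ≤ finrank (ZMod 2) A + I.card := by
  have h3 : W ⊔ A ≤ A ⊔ Submodule.span (ZMod 2) ((I.image v : Finset M) : Set M) := sup_le hW le_sup_left
  have h4 := Submodule.finrank_mono h3
  have h5 := Submodule.finrank_add_le_finrank_add_finrank A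
    (Submodule.span (ZMod 2) ((I.image v : Finset M) : Set M))
  have h6 := finrank_span_image_le I v
  omega

/-- **Tightness**: if moreover `W + A` has dimension `≥ dim A + #I`, every `v t`, `t ∈ I`, lies in
`W + A` and outside `A`. -/
theorem mem_and_not_mem_of_tight (W A : Submodule (ZMod 2) M) (v : ι → M) (I : Finset ι)
    (hW : W ≤ A ⊔ Submodule.span (ZMod 2) ((I.image v : Finset M) : Set M)) {a r : ℕ}
    (ha : finrank (ZMod 2) A ≤ a) (hr : r ≤ finrank (ZMod 2) ↥(W ⊔ A)) (hcount : a + I.card ≤ r)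
    {t : ι} (ht : t ∈ I) : v t ∈ W ⊔ A ∧ v t ∉ A := by
  have h3 : W ⊔ A ≤ A ⊔ Submodule.span (ZMod 2) ((I.image v : Finset M) : Set M) := sup_le hW le_sup_left
  have h4 := Submodule.finrank_mono h3
  have h5 := Submodule.finrank_add_le_finrank_add_finrank A
    (Submodule.span (ZMod 2) ((I.image v : Finset M) : Set M))
  have h6 := finrank_span_image_le I v
  have heq : W ⊔ A = A ⊔ Submodule.span (ZMod 2) ((I.image v : Finset M) : Set M) :=
    Submodule.eq_of_le_of_finrank_eq h3 (by omega)
  have hvt : v t ∈ Submodule.span (ZMod 2) ((I.image v : Finset M) : Set M) :=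
    Submodule.subset_span (Finset.mem_coe.2 (Finset.mem_image_of_mem v ht))
  refine ⟨?_, fun hA => ?_⟩
  · rw [heq]
    exact (le_sup_right : _ ≤ A ⊔ Submodule.span (ZMod 2) ((I.image v : Finset M) : Set M)) hvt
  -- if `v t ∈ A`, the smaller index set already spans
  have hle : A ⊔ Submodule.span (ZMod 2) ((I.image v : Finset M) : Set M) ≤
      A ⊔ Submodule.span (ZMod 2) (((I.erase t).image v : Finset M) : Set M) := by
    refine sup_le le_sup_left (Submodule.span_le.2 ?_)
    intro x hx
    obtain ⟨i, hi, rfl⟩ := Finset.mem_image.1 (Finset.mem_coe.1 hx)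
    by_cases hit : i = t
    · subst hit
      exact (le_sup_left : A ≤ A ⊔ Submodule.span (ZMod 2) (((I.erase i).image v : Finset M) : Set M)) hA
    · exact (le_sup_right : _ ≤ A ⊔ Submodule.span (ZMod 2) (((I.erase t).image v : Finset M) : Set M))
        (Submodule.subset_span (Finset.mem_coe.2
          (Finset.mem_image_of_mem v (Finset.mem_erase.2 ⟨hit, hi⟩))))
  have h7 := Submodule.finrank_mono hle
  have h8 := Submodule.finrank_add_le_finrank_add_finrank A
    (Submodule.span (ZMod 2) (((I.erase t).image v : Finset M) : Set M))
  have h9 := finrank_span_image_le (I.erase t) v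
  have hcard : (I.erase t).card + 1 = I.card := Finset.card_erase_add_one ht
  omega

end Count

/-! ### The slice identity for a computation -/

section Comp

variable {l m n : ℕ} {K : List ℕ} {N : ℕ}

/-- The product vectors `v_i = (f_i(x_s))_s ⊗ w_i` in bits. -/
def vvec (β : BilinComp (psiK l m n K) (Fin N)) (prof : Fin N → ℕ) (xs : List ℕ) (i : Fin N) :
    Fin (xs.length * (l * n)) → ZMod 2 :=
  vecOf _ (kronBits (l * n) xs.length (lval (l * m) xs (prof i)) (bitsOfMat (β.w i)))

/-- **Slices**: `(x_s E_b)_s = ∑_i g_i(E_b) · v_i`. -/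
theorem uvec_eq_sum (β : BilinComp (psiK l m n K) (Fin N)) (prof : Fin N → ℕ)
    (hrep : Represents β prof) (xs : List ℕ) (hxs : ∀ x ∈ xs, memB (l * m) K x = true)
    (b : Fin (m * n)) :
    vecOf (xs.length * (l * n)) (flatRow1 l m n xs b) = ∑ i, (β.g i (vB m n b)) • vvec β prof xs i := by
  funext t
  obtain ⟨t, ht⟩ := t
  have hln : 0 < l * n := Nat.pos_of_ne_zero fun h0 => by rw [h0] at ht; simp at ht
  have hs : t / (l * n) < xs.length := (Nat.div_lt_iff_lt_mul hln).2 ht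
  have hc : t % (l * n) < l * n := Nat.mod_lt _ hln
  have hxmem : xs.getD (t / (l * n)) 0 ∈ xs := by
    rw [List.getD_eq_getElem _ _ hs]; exact List.getElem_mem hs
  have hx : memB (l * m) K (xs.getD (t / (l * n)) 0) = true := hxs _ hxmem
  -- the defining identity at `(x_s, E_b)`, output coordinate `c`
  have key := congrArg (fun M => eC l n ⟨t % (l * n), hc⟩ M)
    (β.map_eq_sum (elemOf l m K _ hx) (vB m n b))
  simp only [map_sum, map_smul, smul_eq_mul] at key
  have lhs : eC l n ⟨t % (l * n), hc⟩ ((psiK l m n K) (elemOf l m K _ hx) (vB m n b)) =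
      if tbit m n (xs.getD (t / (l * n)) 0) b (t % (l * n)) then 1 else 0 := by
    have := eC_mul_vB l m n (xs.getD (t / (l * n)) 0) b ⟨t % (l * n), hc⟩
    simpa [psiK, elemOf, mulBilin_apply] using this
  rw [lhs] at key
  simp only [Finset.sum_apply, Pi.smul_apply, smul_eq_mul, vvec, vecOf]
  rw [testBit_flatRow1 l m n xs b t ht, key]
  refine Finset.sum_congr rfl fun i _ => ?_
  have hf : β.f i (elemOf l m K _ hx) =
      if bdot (l * m) (prof i) (xs.getD (t / (l * n)) 0) then 1 else 0 := by
    rw [hrep i, ← form_ofBits]; rfl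
  rw [hf, eC_eq_testBit, testBit_kronBits _ _ _ _ _ ht, testBit_lval _ _ _ _ hs]
  cases bdot (l * m) (prof i) (xs.getD (t / (l * n)) 0) <;>
    cases (bitsOfMat (β.w i)).testBit (t % (l * n)) <;> simp

/-- With multiplicity one, the index of a class is unique. -/
theorem eq_of_count_eq_one {N : ℕ} {prof : Fin N → ℕ} {ph : List ℕ} (hperm : (List.ofFn prof).Perm ph)
    {g : ℕ} (hc : ph.count g = 1) {i j : Fin N} (hi : prof i = g) (hj : prof j = g) : i = j := by
  by_contra hij
  have h2 : 2 ≤ (Finset.univ.filter fun k => (prof k == g) = true).card := by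
    have hsub : ({i, j} : Finset (Fin N)) ⊆ Finset.univ.filter fun k => (prof k == g) = true := by
      intro k hk
      simp only [Finset.mem_insert, Finset.mem_singleton] at hk
      rcases hk with rfl | rfl <;> simp [hi, hj]
    have := Finset.card_le_card hsub
    rwa [Finset.card_pair hij] at this
  have h3 := Summit.Ventures.MM22.GF2Cert.Census.card_filter_eq_countP' prof (fun x => x == g)
  rw [h3, ← List.count_eq_countP, hperm.count_eq] at h2
  omega

/-- A class of the profile is the class of some product. -/
theorem exists_index_of_mem {N : ℕ} {prof : Fin N → ℕ} {ph : List ℕ} (hperm : (List.ofFn prof).Perm ph)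
    {g : ℕ} (hg : g ∈ ph) : ∃ i, prof i = g := by
  have := hperm.mem_iff.2 hg
  rw [List.mem_ofFn] at this
  obtain ⟨i, hi⟩ := this
  exact ⟨i, hi⟩

/-- `assigned σ g = true` unfolds to an entry of `σ`. -/
theorem exists_of_assigned {σ : List (ℕ × ℕ)} {g : ℕ} (h : assigned σ g = true) : ∃ gc ∈ σ, gc.1 = g := by
  simp only [assigned, List.any_eq_true, beq_iff_eq] at h
  exact h

/-- `assigned σ g = false` means no entry of `σ` has class `g`. -/
theorem forall_of_assigned_false {σ : List (ℕ × ℕ)} {g : ℕ} (h : assigned σ g = false) :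
    ∀ gc ∈ σ, gc.1 ≠ g := by
  intro gc hgc heq
  have : assigned σ g = true := by
    simp only [assigned, List.any_eq_true, beq_iff_eq]; exact ⟨gc, hgc, heq⟩
  rw [h] at this
  exact Bool.false_ne_true this

/-- `valOf` returns the witnessed value of an assigned class. -/
theorem valOf_eq {β : BilinComp (psiK l m n K) (Fin N)} {prof : Fin N → ℕ} {σ : List (ℕ × ℕ)}
    (hσ : ∀ gc ∈ σ, ∀ i, prof i = gc.1 → bitsOfMat (β.w i) = gc.2) {g : ℕ} (hg : assigned σ g = true) {i : Fin N} (hi : prof i = g) :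
    valOf σ g = bitsOfMat (β.w i) := by
  unfold valOf
  split
  · next gc hfind =>
    have hmem := List.mem_of_find?_eq_some hfind
    have hgc : gc.1 = g := by simpa using List.find?_some hfind
    exact (hσ gc hmem i (hi.trans hgc.symm)).symm
  · next hnone =>
    obtain ⟨gc, hgc, hgc1⟩ := exists_of_assigned hg
    have := List.find?_eq_none.1 hnone gc hgc
    simp [hgc1] at this

/-- **The tight-functional lemma at an assignment**: if `L.ok` passes, then for every UNASSIGNED product
`t` meeting `L.xs`, its vector lies in `W + A` and outside `A`; quantitatively, `L.excludes` rejects the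
true output of `t`, which is moreover nonzero. Also the count is not violated. -/
theorem LCert.sound {ph : List ℕ} (β : BilinComp (psiK l m n K) (Fin N)) (prof : Fin N → ℕ)
    (hrep : Represents β prof) (hperm : (List.ofFn prof).Perm ph) {σ : List (ℕ × ℕ)}
    (hσ : ∀ gc ∈ σ, ∀ i, prof i = gc.1 → bitsOfMat (β.w i) = gc.2) (L : LCert)
    (hok : L.ok l m n K ph σ = true) :
    (L.violated l m n K ph σ = false) ∧
    ∀ t : Fin N, lval (l * m) L.xs (prof t) ≠ 0 → assigned σ (prof t) = false →
      (∀ y ∈ L.Y, bdot (L.xs.length * (l * n)) y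
        (kronBits (l * n) L.xs.length (lval (l * m) L.xs (prof t)) (bitsOfMat (β.w t))) = false) ∧
      L.aExcludes l m n σ (prof t) (bitsOfMat (β.w t)) = false := by
  classical
  -- unpack the check
  have hok' := hok
  simp only [LCert.ok, Bool.and_eq_true, List.all_eq_true, decide_eq_true_eq, Bool.not_eq_true'] at hok'
  obtain ⟨⟨⟨⟨⟨⟨⟨hxs, hgA⟩, haV⟩, hech⟩, hRlt⟩, hYG⟩, hYA⟩, hcount⟩ := hok'
  -- the spaces
  let W : Submodule (ZMod 2) (Fin (L.xs.length * (l * n)) → ZMod 2) :=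
    spanOf (L.xs.length * (l * n)) (uList l m n L.xs)
  let A : Submodule (ZMod 2) (Fin (L.xs.length * (l * n)) → ZMod 2) :=
    spanOf (L.xs.length * (l * n)) (L.gAv l m n σ)
  let v : Fin N → (Fin (L.xs.length * (l * n)) → ZMod 2) := vvec β prof L.xs
  let I : Finset (Fin N) := Finset.univ.filter fun i =>
    (lval (l * m) L.xs (prof i) != 0 && !assigned σ (prof i)) = true
  let V' : Submodule (ZMod 2) (Fin (L.xs.length * (l * n)) → ZMod 2) :=
    Submodule.span (ZMod 2) ((I.image v : Finset _) : Set (Fin (L.xs.length * (l * n)) → ZMod 2))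
  -- assigned vectors lie in `A`
  have haVA : ∀ u ∈ aVecs l m n L.xs σ, vecOf (L.xs.length * (l * n)) u ∈ A := fun u hu =>
    vecOf_mem_spanOf_of_mem_allXors _ (L.gAv l m n σ) u (by simpa using haV u hu)
  have hGle : spanOf (L.xs.length * (l * n)) (uList l m n L.xs ++ aVecs l m n L.xs σ) ≤ W ⊔ A := by
    refine Submodule.span_le.2 ?_
    rintro x ⟨g, hg, rfl⟩
    rcases List.mem_append.1 hg with hg | hg
    · exact (le_sup_left : W ≤ W ⊔ A) (vecOf_mem_spanOf hg)
    · exact (le_sup_right : A ≤ W ⊔ A) (haVA g hg)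
  -- (i) W ≤ A ⊔ span (v '' I)
  have hW : W ≤ A ⊔ V' := by
    refine Submodule.span_le.2 ?_
    rintro x ⟨u, hu, rfl⟩
    obtain ⟨b, hb, rfl⟩ := List.mem_map.1 hu
    have hb' : b < m * n := List.mem_range.1 hb
    rw [uvec_eq_sum β prof hrep L.xs hxs ⟨b, hb'⟩]
    refine Submodule.sum_mem _ fun i _ => Submodule.smul_mem _ _ ?_
    by_cases h0 : lval (l * m) L.xs (prof i) = 0
    · have : vvec β prof L.xs i = 0 := by
        simp only [vvec, h0, kronBits_zero_left]; exact vecOf_zero _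
      rw [this]; exact Submodule.zero_mem _
    by_cases ha : assigned σ (prof i) = true
    · obtain ⟨gc, hgc, hgc1⟩ := exists_of_assigned ha
      have hwi : bitsOfMat (β.w i) = gc.2 := hσ gc hgc i hgc1.symm
      refine (le_sup_left : A ≤ A ⊔ V') (haVA _ ?_)
      simp only [aVecs, List.mem_map, List.mem_filter]
      refine ⟨gc, ⟨hgc, ?_⟩, ?_⟩
      · simpa [hgc1] using h0
      · simp only [hgc1, hwi]
    · refine (le_sup_right : V' ≤ A ⊔ V')
        (Submodule.subset_span (Finset.mem_coe.2 (Finset.mem_image_of_mem _ ?_)))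
      simp only [I, Finset.mem_filter, Finset.mem_univ, true_and]
      simpa [h0] using ha
  -- (ii) dim A ≤ |gA|
  have ha : finrank (ZMod 2) A ≤ L.gA.length := by
    have h1 := finrank_spanOf_le (L.xs.length * (l * n)) (L.gAv l m n σ)
    have h2 : (L.gAv l m n σ).length = L.gA.length := by simp [LCert.gAv]
    show finrank (ZMod 2) ↥(spanOf (L.xs.length * (l * n)) (L.gAv l m n σ)) ≤ L.gA.length
    omega
  -- (iii) |R| ≤ dim (W ⊔ A)
  have hr : (L.R l m n σ).length ≤ finrank (ZMod 2) ↥(W ⊔ A) := by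
    refine length_le_finrank_of_echelon _ hech hRlt _ fun r hr => ?_
    obtain ⟨mask, _, rfl⟩ := List.mem_map.1 hr
    exact hGle (vecOf_xorSel_mem _ _ mask)
  -- (iv) the count
  have hI : I.card = unassignedCount l m ph L.xs σ := by
    simp only [I, unassignedCount]
    rw [Summit.Ventures.MM22.GF2Cert.Census.card_filter_eq_countP' prof (fun g => lval (l * m) L.xs g != 0 && !assigned σ g),
      hperm.countP_eq, List.countP_eq_length_filter]
  have hup := finrank_sup_le_of_le W A v I hW
  refine ⟨?_, fun t ht hta => ?_⟩
  · -- not violated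
    simp only [LCert.violated, hok, Bool.true_and, decide_eq_false_iff_not, not_lt]
    omega
  · have htI : t ∈ I := by
      simp only [I, Finset.mem_filter, Finset.mem_univ, true_and]
      simpa [ht] using hta
    obtain ⟨hmem, hnot⟩ := mem_and_not_mem_of_tight W A v I hW ha hr (by omega) htI
    refine ⟨fun y hy => ?_, ?_⟩
    · -- annihilators of `G` and of the `A`-generators vanish on `W ⊔ A ∋ v t`
      have hy0 : dotF _ y (v t) = 0 := by
        have hWk : W ≤ LinearMap.ker (dotF _ y) := Submodule.span_le.2 (by
          rintro x ⟨u, hu, rfl⟩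
          simp [LinearMap.mem_ker, dotF_vecOf, hYG y hy u (List.mem_append_left _ hu)])
        have hAk : A ≤ LinearMap.ker (dotF _ y) := Submodule.span_le.2 (by
          rintro x ⟨u, hu, rfl⟩
          simp [LinearMap.mem_ker, dotF_vecOf, hYA y hy u hu])
        exact LinearMap.mem_ker.1 (sup_le hWk hAk hmem)
      have := dotF_vecOf (L.xs.length * (l * n)) y
        (kronBits (l * n) L.xs.length (lval (l * m) L.xs (prof t)) (bitsOfMat (β.w t)))
      rw [show vecOf _ _ = v t from rfl, hy0] at this
      by_contra hb
      rw [Bool.not_eq_false] at hb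
      rw [hb] at this
      exact zero_ne_one this
    · -- `v t ∉ A`
      have hX : (allXors (L.gAv l m n σ)).elem
          (kronBits (l * n) L.xs.length (lval (l * m) L.xs (prof t)) (bitsOfMat (β.w t))) = false := by
        rw [Bool.eq_false_iff]
        intro hel
        apply hnot
        exact vecOf_mem_spanOf_of_mem_allXors _ (L.gAv l m n σ) _ (by simpa using hel)
      simp only [LCert.aExcludes, hX, Bool.and_false]

end Comp

end Summit.Ventures.MM22.GF2Cert.Realize
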